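import Summits.Ventures.LatticeQCDFlow.Scaling.WilsonSpecificHeatFloor
import Summits.Ventures.LatticeQCDFlow.TrivializingMaps.FisherZeroNearCouplingSharp

/-!
HONEST FRAMING: exact (Metropolis-corrected) sampling algorithms for lattice gauge theory; figures
of merit are autocorrelation/cost numbers at stated couplings and volumes; no continuum-physics
claim.

# WilsonFisherZerosPolynomial — `SU(n)`: A FISHER ZERO OF `Z_L` WITHIN `(4n/c)·u²` OF EVERY REAL
# COUPLING `u ≥ β₀`, IN EVERY VOLUME `L ≥ 2` (lean-2 GEN-10, ours)

Venture-side (OURS).  Cell `lqcd-flow` (pub-lqcd), unit `pub-lqcd-lean-2-g10`, 2026-08-23.  Docking of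
theory2's theorem (SH_W) (item 128, custody-landed as `Scaling/WilsonSpecificHeatFloor*`:
`∃ c = c(d,n,β₀) > 0, ∀ L ≥ 2, ∀ u ≥ β₀, c·#plaq/u² ≤ Var_{π_u}(S_W)`, pure `SU(n)`, `n ≥ 2`, `d ≥ 2`)
on GEN-7's radius law `FisherZeroNearCouplingSharp.wilson_exists_fisherZero_near_norm_le`
(`dist(x, F_{Z_L}) ≤ 4n·#plaq / Var_x(S_W)`):

* **`wilson_exists_fisherZero_near_polynomial`**: for `n ≥ 2`, `d ≥ 2`, `β₀ > 0` there is `C = 4n/c > 0`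
  such that for EVERY `L ≥ 2` and EVERY real `u ≥ β₀` the finite-volume Wilson partition function
  `Z_L(s) = ∫ D[U] e^{−s S_W(U)}` has a complex zero `s₀` with **`|s₀ − u| ≤ C·u²`**;
  **`wilson_infDist_zeroSet_le_polynomial`**: `dist(u, F_{Z_L}) ≤ C·u²`.

READING.  GEN-9's `wilson_exists_fisherZero_near_allCouplings` (every compact `G`) places a zero within
`4N d² 3^d e^{c'|β|}/v_ρ` of every real `β` — a distance growing EXPONENTIALLY with the coupling; for
`SU(n)` the growth is at most QUADRATIC, uniformly in the volume.  The physical expectation (Gaussian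
spin waves: `Var_u(S_W) ≈ (n²−1)(d−1)L^d/(2u²)·…`) is that `4n·#plaq/Var_u` is indeed of order `u²`, so the
exponent `2` is what the variance route can give; whether zeros actually stay at bounded distance from
the real axis as `u → ∞` is not addressed.  NOT CLAIMED: the value of `c` (theory2's constant carries
`e^{−16n(d−1)β₀}` and compactness bounds); zeros for `u < β₀` (there GEN-8/9's window laws apply);
cost / autocorrelation / continuum statements.  Literature grade (cell rule): corollary; new typing.
-/

noncomputable section

open MeasureTheory ProbabilityTheory Complex Metric Set
open Literature.MathematicalPhysics.QuantumFieldTheory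
open Literature.MathematicalPhysics.QuantumFieldTheory.Luscher2010
open Literature.MathematicalPhysics.QuantumFieldTheory.WilsonFlow (coeConfig)
open scoped Matrix Matrix.Norms.Frobenius ContDiff

namespace Summit.Ventures.LatticeQCDFlow.TrivializingMaps

section SUN

variable {d n : ℕ}

/-- **A FISHER ZERO WITHIN `(4n/c)·u²` OF EVERY REAL COUPLING `u ≥ β₀`, EVERY VOLUME** (`SU(n)`, `n ≥ 2`,
`d ≥ 2`, `β₀ > 0`; `c = c(d,n,β₀)` the constant of (SH_W)). [ours] -/
theorem wilson_exists_fisherZero_near_polynomial (hn : 2 ≤ n) (hd : 2 ≤ d) {β₀ : ℝ} (hβ₀ : 0 < β₀) :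
    ∃ C : ℝ, 0 < C ∧ ∀ (L : ℕ) [NeZero L], 2 ≤ L → ∀ u : ℝ, β₀ ≤ u →
      ∃ s₀ : ℂ, ‖s₀ - u‖ ≤ C * u ^ 2 ∧
        complexMGF (fun U => -ambWilsonAction (coeConfig U))
          (trivialMeasure (Matrix.specialUnitaryGroup (Fin n) ℂ) d L) s₀ = 0 := by
  obtain ⟨c, hc, hfloor⟩ :=
    Theory2.WilsonSpecificHeat.wilsonSpecificHeatFloorUniform (d := d) hn hd hβ₀
  refine ⟨4 * n / c, by positivity, fun L _ hL u hu => ?_⟩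
  have hu0 : 0 < u := hβ₀.trans_le hu
  set P : ℝ := (Fintype.card (Plaquette d L) : ℝ) with hP
  have hP0 : 0 < P := by
    rw [hP]; exact_mod_cast WilsonPinching.one_le_card_plaquette (L := L) hd
  set V := variance (wilsonAction (StrongCoupling.defRep n))
    (wilsonMeasure (d := d) (L := L) (StrongCoupling.defRep n) u) with hV
  have hfl : c * P / u ^ 2 ≤ V := by
    have h := hfloor L hL u hu
    rwa [Theory2.WilsonSpecificHeat.variance_amb_eq u] at h
  have hcP : 0 < c * P / u ^ 2 := by positivity
  have hVpos : 0 < V := hcP.trans_le hfl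
  obtain ⟨s₀, hs₀, hz⟩ := wilson_exists_fisherZero_near_norm_le (d := d) (L := L) (n := n) u hVpos
  refine ⟨s₀, hs₀.trans ?_, hz⟩
  -- `4nP/V ≤ 4nP/(cP/u²) = (4n/c)·u²`
  rw [← hP, ← hV]
  calc 4 * (n * P) / V ≤ 4 * (n * P) / (c * P / u ^ 2) :=
        div_le_div_of_nonneg_left (by positivity) hcP hfl
    _ = 4 * n / c * u ^ 2 := by field_simp

/-- **`dist(u, F_{Z_L}) ≤ (4n/c)·u²` for every `u ≥ β₀` and every `L ≥ 2`** (`SU(n)`, `n ≥ 2`, `d ≥ 2`,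
`β₀ > 0`): the distance from a real coupling to the Fisher zero set of the finite-volume Wilson theory
grows at most quadratically with the coupling, uniformly in the volume. [ours] -/
theorem wilson_infDist_zeroSet_le_polynomial (hn : 2 ≤ n) (hd : 2 ≤ d) {β₀ : ℝ} (hβ₀ : 0 < β₀) :
    ∃ C : ℝ, 0 < C ∧ ∀ (L : ℕ) [NeZero L], 2 ≤ L → ∀ u : ℝ, β₀ ≤ u →
      infDist (u : ℂ) {s : ℂ | complexMGF (fun U => -ambWilsonAction (coeConfig U))
        (trivialMeasure (Matrix.specialUnitaryGroup (Fin n) ℂ) d L) s = 0} ≤ C * u ^ 2 := by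
  obtain ⟨C, hC, h⟩ := wilson_exists_fisherZero_near_polynomial (d := d) (n := n) hn hd hβ₀
  refine ⟨C, hC, fun L _ hL u hu => ?_⟩
  obtain ⟨s₀, hs₀, hz⟩ := h L hL u hu
  refine (infDist_le_dist_of_mem (by exact hz)).trans ?_
  rwa [dist_comm, dist_eq_norm]

end SUN

end Summit.Ventures.LatticeQCDFlow.TrivializingMaps

end
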